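import Summits.QuantumFields.YangMills.Theorems.UnitScaleTiltProp7CovLineFaceTrace
import Summits.QuantumFields.YangMills.Theorems.UnitScaleTiltProp7BlockLineCount
import HarnessLib

/-!
# Route `UnitScaleTilt`, crux K1 «MinimiserStabilityRegPr» (stmt-QuantumFields-19200), route-R E′ S3 K-form engine (DESIGN-S3-KFORM-ENGINE-g15) — ROW R3′, THE (E)-ROW INHABITED:
# at the `k`-blocks, the engine's covariant straight-line block functional minus its per-line face functional is bounded in `ℓ²` by the LONGITUDINAL covariant gradient energy,
# `Σ_c ‖LINE_c − FACE_c‖² ≤ ℓ⁴·ℓ^{−d}·G_long` (`ℓ = L^k`; at `d = 3`: `ℓ·G_long`) — junk-free, any bi-contractive frames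

Cell `ym3-torus`, width seat `ym3-torus-px17` (gen 2); discharges the displayed row `hE` of the R3′ door ✓ `Prop7CovFaceFluxRow.sum_normSq_centreDiff_le_of_rows` (this seat) in the letters of
✓ `Prop7LineIterVsEngineOfTower.sum_normSq_lineIter_sub_engine_le_of_tower` (block offsets `Site.fibreSite 0 k c.src r`, straight transports `holT V x (replicate s (c.dir,true))`, comb prefixes
`w c r`, an outer frame change `gL c · gR c`).  THEOREMS ONLY (0 `def`, 0 `sorry`); `--supports stmt-QuantumFields-19200`, count-neutral.  YM₃ on T³ is a ladder rung (R3), not the Clay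
problem; nothing here claims a stub, the crux, d = 4 or the mass gap.

WHY.  Flat: ✓ `Prop7FaceFluxLineMean.sum_sq_lineMean_sub_faceMean_le` (`Σ_c (M_kB(c) − ℓV⁻¹FS B c)² ≤ ℓ²V⁻¹·G_long`).  Covariant: per line ✓p669005 `Prop7CovLineFaceTrace.normSq_blockLineMean_sub_faceMean_le`
(the face value read PER LINE with the line's own transport — exact telescoping, flat constant `1`), the outer frame change is a contraction, and the block lines cover every fine bond `ℓ`
times (✓ `Prop7BlockLineCount.sum_block_lines`).

WHAT IS PROVED (ns `…Theorems.Prop7CovFaceFluxLineStep`): ★★ `sum_normSq_lineFun_sub_faceFun_le` — for a `U1` background `V` on the finest torus, contractions `gL c, gR c`, `U1` prefixes `w c r`,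
face indices `t₀ c r < L^k`, any bond field `Y`:
`Σ_{c : PBond P k} ‖V_k⁻¹•(gL_c·A_c·gR_c) − V_k⁻¹•(gL_c·(ℓ•F_c)·gR_c)‖² ≤ ℓ⁴·V_k⁻¹·Σ_{b : PBond P 0}‖R(V_b)Y(b₊-bond) − Y(b)‖²`, `A_c = Σ_rΣ_{s<ℓ}R(w_{c,r}V([x_r, x_r+se]))Y(x_r+se, μ_c)`,
`F_c = Σ_r R(w_{c,r}V([x_r, x_r+t₀e]))Y(x_r+t₀e, μ_c)`, `V_k = ℓ^d`.
HONEST SCOPE.  Kinematics; no plaquette variable, no smallness; nothing of Bałaban's asserted.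

References: T. Bałaban, CMP 95 (1984) 17–40 [Balaban1984PropagatorsI] ((1.18)–(1.21) pp.20–21, Prop. 1.1 (1.90) p.33); CMP 99 (1985) 75–102 [Balaban1985RegularSpaces] ((1.1) p.76);
CMP 102 (1985) 277–309 [Balaban1985Variational] (Prop. 7 p.299).
-/

set_option autoImplicit false

noncomputable section

open scoped BigOperators Matrix.Norms.L2Operator

namespace Summit.QuantumFields.YangMills.Theorems.Prop7CovFaceFluxLineStep

open Literature.MathematicalPhysics.QuantumFieldTheory.Balaban1983to89
open Finset
open B7Prop1Explicit (U1)
open B7Eq78Linearization (conjR)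
open B10Eq27TorusAxialLog (holT)
open Summit.QuantumFields.YangMills.Theorems.Prop7CovLineFaceTrace (normSq_blockLineMean_sub_faceMean_le)
open Summit.QuantumFields.YangMills.Theorems.Prop7BlockLineCount (sum_block_lines)

variable {P : Params} {k : ℕ} {N : ℕ} [NeZero N]

/-- ★★ **THE (E)-ROW OF R3′ AT THE BLOCKS**: line functional minus per-line face functional, summed over the `k`-bonds, is at most `ℓ⁴ℓ^{−d}` times the longitudinal covariant
gradient energy of `Y` (`ℓ = L^k`; `d = 3`: `ℓ·G_long`).  The outer frame change `gL c · gR c` is any pair of contractions (at the consumer: conjugation by the `SU(N)` transport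
from the block centre), the prefixes `w c r` any `U1` units (the combs), the face indices `t₀ c r < ℓ` free (the line's own far-face crossing).
[cite: Balaban1984PropagatorsI, (1.18)-(1.21) pp.20-21, Prop. 1.1 (1.90) p.33; Balaban1985RegularSpaces, (1.1) p.76; Balaban1985Variational, Prop. 7 p.299] -/
theorem sum_normSq_lineFun_sub_faceFun_le (h : P.sitesPerDir 0 = P.L ^ k * P.sitesPerDir k)
    {V : GaugeField P 0 (Matrix (Fin N) (Fin N) ℂ)ˣ} (hV : ∀ b, V b ∈ U1 (Matrix (Fin N) (Fin N) ℂ))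
    (gL gR : PBond P k → Matrix (Fin N) (Fin N) ℂ) (hgL : ∀ c, ‖gL c‖ ≤ 1) (hgR : ∀ c, ‖gR c‖ ≤ 1)
    (w : PBond P k → (Fin P.d → Fin (P.L ^ k)) → (Matrix (Fin N) (Fin N) ℂ)ˣ) (hw : ∀ c r, w c r ∈ U1 (Matrix (Fin N) (Fin N) ℂ))
    (t₀ : PBond P k → (Fin P.d → Fin (P.L ^ k)) → ℕ) (ht₀ : ∀ c r, t₀ c r < P.L ^ k)
    (Y : PBond P 0 → Matrix (Fin N) (Fin N) ℂ) :
    ∑ c : PBond P k, ‖(((P.L : ℝ) ^ k) ^ P.d)⁻¹ • (gL c * (∑ r : Fin P.d → Fin (P.L ^ k), ∑ s ∈ range (P.L ^ k),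
            conjR (w c r * holT V (Site.fibreSite 0 k c.src r) (List.replicate s (c.dir, true)))
              (Y ⟨(fun z : Site P 0 => z.shift c.dir)^[s] (Site.fibreSite 0 k c.src r), c.dir⟩)) * gR c)
        - (((P.L : ℝ) ^ k) ^ P.d)⁻¹ • (gL c * (((P.L : ℝ) ^ k) • ∑ r : Fin P.d → Fin (P.L ^ k),
            conjR (w c r * holT V (Site.fibreSite 0 k c.src r) (List.replicate (t₀ c r) (c.dir, true)))
              (Y ⟨(fun z : Site P 0 => z.shift c.dir)^[t₀ c r] (Site.fibreSite 0 k c.src r), c.dir⟩)) * gR c)‖ ^ 2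
      ≤ ((P.L : ℝ) ^ k) ^ 4 * (((P.L : ℝ) ^ k) ^ P.d)⁻¹ *
          ∑ b : PBond P 0, ‖conjR (V b) (Y ⟨b.src.shift b.dir, b.dir⟩) - Y b‖ ^ 2 := by
  -- letters
  set ℓ : ℝ := (P.L : ℝ) ^ k with hℓ
  set Vk : ℝ := ((P.L : ℝ) ^ k) ^ P.d with hVk
  have hL0 : (0 : ℝ) < P.L := by exact_mod_cast P.L_pos
  have hℓ0 : 0 < ℓ := by positivity
  have hVk0 : 0 < Vk := by positivity
  have hℓn : 0 < P.L ^ k := pow_pos P.L_pos k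
  have hcard : ((Finset.univ : Finset (Fin P.d → Fin (P.L ^ k))).card : ℝ) = Vk := by
    rw [Finset.card_univ, Fintype.card_fun, Fintype.card_fin, Fintype.card_fin, hVk]
    push_cast
    ring
  -- the longitudinal gradient letter
  set g : PBond P 0 → ℝ := fun b => ‖conjR (V b) (Y ⟨b.src.shift b.dir, b.dir⟩) - Y b‖ ^ 2 with hg
  -- per coarse bond: T-F, then the contraction of the frame change
  have hpt : ∀ c : PBond P k,
      ‖Vk⁻¹ • (gL c * (∑ r : Fin P.d → Fin (P.L ^ k), ∑ s ∈ range (P.L ^ k),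
            conjR (w c r * holT V (Site.fibreSite 0 k c.src r) (List.replicate s (c.dir, true)))
              (Y ⟨(fun z : Site P 0 => z.shift c.dir)^[s] (Site.fibreSite 0 k c.src r), c.dir⟩)) * gR c)
        - Vk⁻¹ • (gL c * (ℓ • ∑ r : Fin P.d → Fin (P.L ^ k),
            conjR (w c r * holT V (Site.fibreSite 0 k c.src r) (List.replicate (t₀ c r) (c.dir, true)))
              (Y ⟨(fun z : Site P 0 => z.shift c.dir)^[t₀ c r] (Site.fibreSite 0 k c.src r), c.dir⟩)) * gR c)‖ ^ 2
      ≤ ℓ ^ 3 * Vk⁻¹ * ∑ r : Fin P.d → Fin (P.L ^ k), ∑ s ∈ range (P.L ^ k),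
          g ⟨(fun z : Site P 0 => z.shift c.dir)^[s] (Site.fibreSite 0 k c.src r), c.dir⟩ := by
    intro c
    -- abbreviations for the inner sums
    set A : Matrix (Fin N) (Fin N) ℂ := ∑ r : Fin P.d → Fin (P.L ^ k), ∑ s ∈ range (P.L ^ k),
        conjR (w c r * holT V (Site.fibreSite 0 k c.src r) (List.replicate s (c.dir, true)))
          (Y ⟨(fun z : Site P 0 => z.shift c.dir)^[s] (Site.fibreSite 0 k c.src r), c.dir⟩) with hA
    set F : Matrix (Fin N) (Fin N) ℂ := ∑ r : Fin P.d → Fin (P.L ^ k),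
        conjR (w c r * holT V (Site.fibreSite 0 k c.src r) (List.replicate (t₀ c r) (c.dir, true)))
          (Y ⟨(fun z : Site P 0 => z.shift c.dir)^[t₀ c r] (Site.fibreSite 0 k c.src r), c.dir⟩) with hF
    set X : Matrix (Fin N) (Fin N) ℂ := (Vk * ℓ)⁻¹ • A - Vk⁻¹ • F with hX
    -- T-F per line family
    have hTF : ‖X‖ ^ 2 ≤ ℓ * Vk⁻¹ * ∑ r : Fin P.d → Fin (P.L ^ k), ∑ s ∈ range (P.L ^ k),
        g ⟨(fun z : Site P 0 => z.shift c.dir)^[s] (Site.fibreSite 0 k c.src r), c.dir⟩ := by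
      have h1 := normSq_blockLineMean_sub_faceMean_le hV (Finset.univ : Finset (Fin P.d → Fin (P.L ^ k))) hVk0 hcard hℓn
        (w c) (fun r _ => hw c r) (fun r => Site.fibreSite 0 k c.src r) (t₀ c) (fun r _ => ht₀ c r) (fun x => Y ⟨x, c.dir⟩) c.dir
      have hℓc : ((P.L ^ k : ℕ) : ℝ) = ℓ := by rw [hℓ]; push_cast; rfl
      rw [hℓc] at h1
      simpa only [hX, hA, hF, hg] using h1
    -- the difference is `ℓ • (gL · X · gR)`
    have hdiff : Vk⁻¹ • (gL c * A * gR c) - Vk⁻¹ • (gL c * (ℓ • F) * gR c) = ℓ • (gL c * X * gR c) := by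
      rw [hX, Matrix.mul_sub, Matrix.sub_mul, smul_sub, Matrix.mul_smul, Matrix.smul_mul, Matrix.mul_smul, Matrix.smul_mul,
        Matrix.mul_smul, Matrix.smul_mul, smul_smul, smul_smul, smul_smul]
      have e1 : ℓ * (Vk * ℓ)⁻¹ = Vk⁻¹ := by field_simp
      rw [e1, mul_comm Vk⁻¹ ℓ]
    rw [hdiff, norm_smul, Real.norm_eq_abs, abs_of_pos hℓ0, mul_pow]
    have hc : ‖gL c * X * gR c‖ ≤ ‖X‖ := by
      calc ‖gL c * X * gR c‖ ≤ ‖gL c‖ * ‖X‖ * ‖gR c‖ := (norm_mul_le _ _).trans (mul_le_mul_of_nonneg_right (norm_mul_le _ _) (norm_nonneg _))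
        _ ≤ 1 * ‖X‖ * 1 := by
            refine mul_le_mul (mul_le_mul_of_nonneg_right (hgL c) (norm_nonneg _)) (hgR c) (norm_nonneg _) ?_
            exact mul_nonneg zero_le_one (norm_nonneg _)
        _ = ‖X‖ := by ring
    have hc2 : ‖gL c * X * gR c‖ ^ 2 ≤ ‖X‖ ^ 2 := pow_le_pow_left₀ (norm_nonneg _) hc 2
    calc ℓ ^ 2 * ‖gL c * X * gR c‖ ^ 2 ≤ ℓ ^ 2 * ‖X‖ ^ 2 := mul_le_mul_of_nonneg_left hc2 (sq_nonneg _)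
      _ ≤ ℓ ^ 2 * (ℓ * Vk⁻¹ * ∑ r : Fin P.d → Fin (P.L ^ k), ∑ s ∈ range (P.L ^ k),
            g ⟨(fun z : Site P 0 => z.shift c.dir)^[s] (Site.fibreSite 0 k c.src r), c.dir⟩) := mul_le_mul_of_nonneg_left hTF (sq_nonneg _)
      _ = _ := by ring
  -- sum over the coarse bonds and count the lines
  have hlines := sum_block_lines h g
  calc _ ≤ ∑ c : PBond P k, ℓ ^ 3 * Vk⁻¹ * ∑ r : Fin P.d → Fin (P.L ^ k), ∑ s ∈ range (P.L ^ k),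
          g ⟨(fun z : Site P 0 => z.shift c.dir)^[s] (Site.fibreSite 0 k c.src r), c.dir⟩ := Finset.sum_le_sum fun c _ => hpt c
    _ = ℓ ^ 3 * Vk⁻¹ * (ℓ * ∑ b : PBond P 0, g b) := by rw [← Finset.mul_sum, hlines]
    _ = ℓ ^ 4 * Vk⁻¹ * ∑ b : PBond P 0, g b := by ring

end Summit.QuantumFields.YangMills.Theorems.Prop7CovFaceFluxLineStep

end
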